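import Summits.BirchSwinnertonDyer.BirchSwinnertonDyer.Theorems.AlignedTransportAtTwoBSDOfMainConjectureRankOneAtTwoSigmaSqTwoDworkPackage
import Summits.BirchSwinnertonDyer.BirchSwinnertonDyer.Theorems.AlignedTransportAtTwoBSDOfMainConjectureRankOneAtTwoSigmaSqTwoUniversalSpecialization
import Summits.BirchSwinnertonDyer.BirchSwinnertonDyer.Theorems.AlignedTransportAtTwoBSDOfMainConjectureRankOneAtTwoSigmaSqTwoConstantFixedPoint
import Literature.RingTheory.FormalGroups.DworkFrobeniusLift
import HarnessLib

/-!
# DISCHARGE of the PRINT stub `stub_sigmaSqTwo`: Mazur–Tate 1991 Thm. 3.1 at `p = 2` (Silverman 2005 §5 Rem. 2) —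
# `Literature.NumberTheory.EllipticCurves.mazurTate_sigmaSq_existsUnique_two` HOLDS

Cell `bsd-f1-sign2`, WIDTH-5 attach seat `bsd-line-att-p3` g9 (crux C3′ = stmt-BirchSwinnertonDyer-23008, registered stub `stub_sigmaSqTwo`;
plan `Cruxes/BSDOfMainConjectureRankOneAtTwo/SIGMASQ-AT-TWO-att-p3.md`). THEOREMS ONLY. This file assembles the discharge (steps S1–S6 of the plan,
all landed in the tree by seats `att-p3` g8/g9): for every globally minimal `W/ℚ` with good ORDINARY reduction at `2` there is exactly one
`Σ ∈ z² + z³ℤ₂⟦z⟧` satisfying all squared `n`-division identities. BSD is NOT proved by any of this; the consumers (`…Disegni`, `…MinimalTwinBSDTwo…`,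
bsd-goldfeld 19141) merely lose the hypothesis `(hMT : mazurTate_sigmaSq_existsUnique_two)`.

PROOF (Blakestad–Grant's method at `p = 2`, squared). Over the universal ordinary `a₁`-chart ring `R̂₂ = ℤ[B₂,B₆][1/D]^` (S1,
`Literature…PadicSigmaSqTwoUniversalRing`): (S3.1) Newton gives the parameter `ν` with `B₆ = g₂X₀²`, `g₂ = (1 + 4B₂)(1 + ν)/q`, `X₀ = −1 − 4B₂ − 64g₂`
(`frobParam_exists_nu`, `frobParam_B6_eq`) — the canonical `2`-torsion point `Q = (X₀/4, −X₀/8)`; (S3.2–3) the Frobenius model `E″ = vc • V′` of Vélu's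
quotient `𝓔/⟨Q⟩`, `vc = [2u₂; R₁/4, u₂ − ½, −R₁/8]`, is the chart curve `⟨1, b₂′, 0, 0, b₆′⟩ = 𝓔^α` for the Frobenius lift `α = specialize b₂′ b₆′`
(`frobModel_curve`, `frobParam_beta2/6_sub_mem`, `specialize_sub_sq_mem`); (S5′) the Mazur–Tate constant is the `2`-adic fixed point
`4u₂²α(c) − 2c = 8δ` (`exists_four_mul_sq_mul_map_sub_two_mul_eq`); (S2/S6) the odd normalised solution `σ_c` over `K₂ = R̂₂[1/2]`
(`exists_isFormallyOdd_satisfiesSigmaODE_const_ratAlgebra`) and its base change `σ_c^α` (`satisfiesSigmaODE_map_ringHom`) satisfy the squared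
`2`-isogeny functional equation (`velu_two_X_sq_mul_sq_subst_eq_domain`), i.e. Dwork's shape `H″(T) = H²V`, `H = (σ/z)²`
(`dworkShape_of_sq_functionalEquation_unit`); (S3.4) `T = u₂z(2 − z)Xs𝒰/𝔇 ≡ z²`, `V = 𝔇²/(𝒬𝒰²) ≡ 1 (mod 2)` with coefficients in `R̂₂`
(`frobModel_T_mul_calD`, `frobModel_V_eq`, `frob_coeff_N2_sub_mem`, `frob_coeff_calD_sq_sub_mem`); (S6) the tree's Dwork lemma
`Literature.RingTheory.FormalGroups.coeff_mem_of_map_subst_eq_pow_mul` gives `H ∈ R̂₂⟦z⟧`, hence `σ² = z²H ∈ R̂₂⟦z⟧`, and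
`mazurTate_sigmaSq_existsUnique_two_of_universal` (specialisation, Blakestad–Grant Thm. 15; uniqueness from `…SigmaSqTwoNetting`) concludes.

* `stub_sigmaSqTwo : mazurTate_sigmaSq_existsUnique_two` (the registered stub of C3′, by name);
* `mazurTate_sigmaSq_existsUnique_two_holds` (the fact-discharge alias).

## Sources
B. Mazur, J. Tate, Duke Math. J. 62 (1991), §2, Thm. 3.1 [cite: MazurTate1991, Thm. 3.1]; J. H. Silverman, Math. Ann. 332 (2005), §5 Thm. 11 and Rem. 2
[cite: Silverman2005DivPoly, §5 Rem. 2]; C. Blakestad, D. Grant, J. Number Theory 249 (2023), Thm. 1, Prop. 7, Lemma 12, Prop. 13, Thm. 15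
[cite: BlakestadGrant2023, Thm. 1]; N. Koblitz, GTM 58, Ch. IV §2 Lemma 3 (Dwork) [cite: Koblitz1984, Ch. IV §2 Lemma 3].
-/

noncomputable section

set_option linter.dupNamespace false
set_option autoImplicit false

open scoped Classical
open PowerSeries WeierstrassCurve Literature.NumberTheory.EllipticCurves
open Literature.NumberTheory.EllipticCurves.PadicSigmaSqTwo.Universal

namespace Summit.BirchSwinnertonDyer.BirchSwinnertonDyer.Theorems.AlignedTransportAtTwoSigmaSqTwo

/-- **The PRINT stub `stub_sigmaSqTwo` of crux C3′ (stmt-BirchSwinnertonDyer-23008): Mazur–Tate's `σ²` at a good ordinary `2` exists and is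
unique** — `Literature.NumberTheory.EllipticCurves.mazurTate_sigmaSq_existsUnique_two` holds (Mazur–Tate 1991 Thm. 3.1 / Silverman 2005 §5 Rem. 2,
proved along Blakestad–Grant 2023 at `p = 2`; see the module docstring for the chain). [cite: MazurTate1991, Thm. 3.1]
[cite: Silverman2005DivPoly, §5 Rem. 2] [cite: BlakestadGrant2023, Thm. 1] -/
theorem stub_sigmaSqTwo : mazurTate_sigmaSq_existsUnique_two := by
  -- §0 the universal ring and its Frobenius parameter `ν`
  haveI hIC : IsAdicComplete (Ideal.span {(2 : completeRing)}) completeRing := isAdicComplete_completeRing'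
  obtain ⟨nu, hΦ⟩ := frobParam_exists_nu (A := completeRing) univB2 univB6
  obtain ⟨iq, hiq⟩ := (frobParam_isUnit_q (A := completeRing) nu).exists_right_inv
  obtain ⟨iu2, hiu2⟩ := (frobParam_isUnit_u2 (A := completeRing) univB2).exists_right_inv
  obtain ⟨g2, hg2⟩ : ∃ g2 : completeRing, g2 =
      (1 + 4 * univB2) * (1 + nu) * iq := ⟨_, rfl⟩
  obtain ⟨X0, hX0⟩ : ∃ X0 : completeRing, X0 =
      -1 - 4 * univB2 - 64 * g2 := ⟨_, rfl⟩
  obtain ⟨d, hd⟩ : ∃ d : completeRing, d =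
      -(1 + 4 * nu) * g2 := ⟨_, rfl⟩
  have hB6 : univB6 = g2 * X0 ^ 2 := frobParam_B6_eq hiq hg2 hX0 hΦ
  have hβ2m := frobParam_beta2_sub_mem hiq hiu2
  have hβ6m := frobParam_beta6_sub_mem hiq hiu2 hg2 hX0 hB6
  have hDm := frobParam_D_sub_mem hiq hiu2 hg2 hX0 hB6 rfl rfl
  rw [← univD_eq] at hDm
  have hD := isUnit_of_sub_mem ((isUnit_univD).pow 2) hDm
  haveI hIC' : IsAdicComplete (Ideal.span {((2 : ℕ) : completeRing)}) completeRing := isAdicComplete_completeRing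
  have hspec := universalCurve_map_specialize _ _ hD
  obtain ⟨α₀, hα₀⟩ : ∃ α₀ : completeRing →+* completeRing, α₀ = specialize _ _ hD := ⟨_, rfl⟩
  have hα₀sq : ∀ x, α₀ x - x ^ 2 ∈ Ideal.span {(2 : completeRing)} := fun x => by
    rw [hα₀]; exact specialize_sub_sq_mem _ _ hD hβ2m hβ6m x
  have hEα₀ := hspec
  rw [← hα₀] at hEα₀
  obtain ⟨α, hα⟩ : ∃ α : completeRingQ →+* completeRingQ, α =
      extendQ α₀ := ⟨_, rfl⟩
  -- the sigma constant: the `2`-adic fixed point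
  obtain ⟨c, hc⟩ := exists_four_mul_sq_mul_map_sub_two_mul_eq α₀ (1 + 2 * univB2) (4 * d)
  -- §1 the odd normalised solution `σ_c` over `K₂` and the Dwork package
  obtain ⟨i2, hi2⟩ := (isUnit_two_completeRingQ).exists_right_inv
  have hαam : α.comp (algebraMap completeRing completeRingQ) = (algebraMap completeRing completeRingQ).comp α₀ :=
    RingHom.ext fun x => by rw [hα]; exact extendQ_algebraMap α₀ x
  have h1R : universalCurve.a₁ = 1 := universalCurve_a₁
  have h2R : universalCurve.a₂ = univB2 := universalCurve_a₂
  have h3R : universalCurve.a₃ = 0 := universalCurve_a₃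
  have h4R : universalCurve.a₄ = 0 := universalCurve_a₄
  have h6R : universalCurve.a₆ = g2 * X0 ^ 2 := by rw [universalCurve_a₆, hB6]
  obtain ⟨σ, hσ0, hσ1, hodd, hODE⟩ :=
    exists_isFormallyOdd_satisfiesSigmaODE_const_ratAlgebra (universalCurve.map (algebraMap completeRing completeRingQ)) ((algebraMap completeRing completeRingQ) c)
  obtain ⟨T, VD, hT0, hφ, hu0, hu, heq⟩ := frob_dwork_package (algebraMap completeRing completeRingQ) α₀ α hαam hiq hiu2 hg2 hX0 hd universalCurve
    h1R h2R h3R h4R h6R hEα₀ hc hi2 hσ0 hσ1 hodd hODE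
  -- §2 Dwork's lemma: `H = (σ/z)² ∈ R̂₂⟦z⟧`
  obtain ⟨H, hH⟩ : ∃ H : PowerSeries completeRingQ, H =
      sigmaShift σ ^ 2 := ⟨_, rfl⟩
  rw [← hH] at heq
  have h1K : (universalCurve.map (algebraMap completeRing completeRingQ)).a₁ = 1 := by rw [map_a₁, universalCurve_a₁, map_one]
  obtain ⟨hs0, hs1⟩ := frob_H_coeffs (universalCurve.map (algebraMap completeRing completeRingQ)) h1K hH hσ0 hσ1 hodd
  have hs1' : coeff 1 H ∈ intSubring := by rw [hs1]; exact one_mem _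
  have hpK : IsUnit ((2 : ℕ) : completeRingQ) := by exact_mod_cast isUnit_two_completeRingQ
  have hαA : ∀ r ∈ intSubring, α r ∈ intSubring := fun r hr => by rw [hα]; exact extendQ_mem_intSubring α₀ hr
  have hαsq : ∀ r ∈ intSubring, ∃ a ∈ intSubring, α r = r ^ (2 : ℕ) + ((2 : ℕ) : completeRingQ) * a :=
    fun r hr => by rw [hα]; exact exists_extendQ_eq_sq_add' α₀ hα₀sq hr
  have hHint := Literature.RingTheory.FormalGroups.coeff_mem_of_map_subst_eq_pow_mul 2 intSubring α hpK
    exists_natCast_pow_mul_mem_intSubring hαA hαsq hT0 hφ hs0 hs1' hu0 hu heq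
  -- §3 `σ² = z²·H ∈ R̂₂⟦z⟧` and specialisation (Blakestad–Grant Thm. 15)
  have hint := frob_coeff_sq_mem intSubring hH hσ0 hHint
  exact mazurTate_sigmaSq_existsUnique_two_of_universal hσ0 hσ1 hodd hODE hint

/-- **Fact discharged**: `mazurTate_sigmaSq_existsUnique_two` holds (alias of `stub_sigmaSqTwo`). [cite: MazurTate1991, Thm. 3.1] -/
theorem mazurTate_sigmaSq_existsUnique_two_holds : mazurTate_sigmaSq_existsUnique_two := stub_sigmaSqTwo

end Summit.BirchSwinnertonDyer.BirchSwinnertonDyer.Theorems.AlignedTransportAtTwoSigmaSqTwo
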